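import Summits.BirchSwinnertonDyer.Rank1Residual.Partition.MainConjecturesIrreducibleClass
import Literature.NumberTheory.EllipticCurves.YanZhu2026.CyclotomicMainTheoremIntegral
import HarnessLib

/-!
# The good-ordinary IRREDUCIBLE column at MAIN-CONJECTURE level, the prime `p = 3` (row C16 =
# Yan–Zhu 2026) — the typed main conjecture is Yan–Zhu's Theorem 4.9 there

HONEST FRAMING (cell `b2b-bsdres`, run/shared/lean/b2b/bsd-rank1-residual/; verbatim): the goal is to
DELETE the COMBINATION-SHAPED residual classes for ALL analytic-rank `≤ 1` curves over `ℚ` — "full BSD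
formula for every rank `≤ 1` curve in class `C`" assembled STRICTLY from published theorems — so
that the rank-`≤ 1` remainder becomes exactly the CONSTRUCTION-SHAPED classes, which are TYPED
(missing-input `Prop`s), NOT attempted; this is not "finishing BSD". Theorems only; NO named fact and
NO definition; every published theorem enters as one of the tree's existing named Literature facts
BY NAME; every unproved statement enters as an EXPLICIT binder; nothing about any particular curve
is asserted; no label changes. Unit `b2b-bsdres-lit-glue` (GLUE seat), gen 2 — third file of the
irreducible column (`MainConjecturesIrreducible.lean`: adapters, row C2 ∩ {r = 0}, rank one at a
datum; `MainConjecturesIrreducibleClass.lean`: rank one at the class level, generic in the odd prime),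
written after typing Yan–Zhu's integral cyclotomic main theorem at odd `p`
(`YanZhu2026.thm49_charIdeal_eq_padicLFunction_integral`, same seat): gen-0's
`Partition/MainConjectures.lean` §3 row C16 said "the tree types only Thm. 4.15 … so the
main-conjecture input enters as `MazurMainConjecture W 3`".

## What this file records (`p = 3`, good ordinary, `E[3]` irreducible)

| row / locus | main-conjecture input (typed, PUBLISHED) | control / leading-term / image inputs (named facts) | theorem here |
|---|---|---|---|
| the typed MC on {odd `p`, (irr), (Im)} | Yan–Zhu 2026 Thm. 4.9 (second clause) IS `MazurMainConjecture W p` there; at `p > 3` it implies BCS 2025 Thm. 1.1.2 (b) as statements | — | `mazurMainConjecture_of_yzThm49`, `bcsThm112b_of_yzThm49` |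
| **C16** = (`p = 3`, ord, irr, surj ∨ ram): the typed MC | Thm. 4.9 | (Im) at `3`: surj(3) + good reduction ⇒ `3`-adic surjectivity (Wuthrich 2014 Lemma 20, `hW20`) ⇒ (Im) (`X9.bigIm_three_of_surj`); (irr) + (ram) ⇒ (Im) (`X9.bigIm_of_irr_of_ram`) | `RowC16.mazurMainConjecture_of_yzThm49` |
| **C16 ∩ {r = 0}** (Yan–Zhu Thm. 4.15, `r = 0`) | Thm. 4.9 | Greenberg 1999 Thm. 4.1 (odd `p`); modularity; GZK; `hW20` | **`RowC16.bsdp_rankZero_of_yzThm49`** — NO `@[conjecture]` binder left |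
| **C16 ∩ {r = 1}**, `3 ∤ ∏c_ℓ` — the PRINTED route of Thm. 4.15 ("Choosing an imaginary quadratic field `K` as above [`p` split, Heegner hypothesis], the rank `1` `p`-part BSD formula comes from (the integral part of) Theorem (ac) [= Thm. 4.12, the BDP / Heegner-point main conjectures for the CLASSICAL `X₀(N)` Heegner point at odd `p`] and descent arguments (see [JSW])", §4.6) | STEP L `X11b.IndexLowerBoundAt W 3 K P` (TYPED binder `hL`) over a field with `d_K` odd `< −4`, every `ℓ ∣ N` split, `3` split (⊇ the data of YZ Thm. 4.12); + Thm. 4.9 for the twist | Gross–Zagier; Kolyvagin (×2); Greenberg Thm. 4.1; Hoffstein–Luo; Mazur 1978; modularity (×3); GZK; `hW20` | **`RowC16.bsdp_rankOne_of_indexLowerBoundAt_of_yzThm49`**, `RowC16.bsdp_of_yzThm49_of_indexLowerBoundAt` (`r ≤ 1`: no `@[conjecture]`, no Schneider certificate — replaces gen-0's `RowC16.bsdp_rankOne_of_mazurMainConjecture_of_schneider` for this row) |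
| the column at `p = 3` | granted Thm. 4.9 + `hW20`: "MC at EVERY good ordinary irreducible `(E,3)`" ⟺ "… at the NON-SURJECTIVE ones" (the image locus of the cell's class X10b = X10 ∧ ¬surj(3)) | | `forall_mazurMainConjecture_irreducible_three_iff_nonSurj` |

Documentation flag carried by the Yan–Zhu facts (referee R9.1/R10.1): `YZ26@3-BF-ERL-Ohta` (a
proof-level input at `p = 3` points to the preprint BSTW arXiv:2409.01350, still a preprint on
2026-08-20); the statements used are the REFEREED statements. The typed STEP L at `p = 3` has, as at
`p > 3`, a PUBLISHED main-conjecture-level antecedent for the classical Heegner point (YZ Thm. 4.12,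
`p` split, Heegner hypothesis, (irr) on `G_K`, (Im) for the integral form) but is displayed by no
source as an inequality, so it stays a typed input.

References: Yan–Zhu, J. Algebra 693 (2026) = arXiv:2412.20078v4, Thm. 4.9, 4.12, 4.15 and its proof,
(Im), Rem. 1.3 [YanZhu2024MainConjNonCM]; Burungale–Castella–Skinner 2025 Thm. 1.1.2 (b)
[BurungaleCastellaSkinner2025]; Wuthrich 2014 Lemma 20 [Wuthrich2014]; Greenberg LNM 1716 Thm. 4.1
[GreenbergLNM1716]; Hoffstein–Luo 1997 [HoffsteinLuo1997]; Mazur 1978 Cor. 4.1 [Mazur1978];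
Jetchev–Skinner–Wan 2017 §7.4 [JetchevSkinnerWan2017]; Miller 2011 Def. 1.1 [Miller2011LMS];
RESIDUAL-CASES.md §a.1 C16, §a.2 X10; HOME/b2b-bsdres-lit-glue/GLUE.md.
-/

set_option autoImplicit false

noncomputable section

open scoped Classical MatrixGroups ModularForm

open CongruenceSubgroup WeierstrassCurve NumberField Literature.NumberTheory.EllipticCurves
  Literature.NumberTheory.EllipticCurves.ModularForms
  Literature.NumberTheory.EllipticCurves.Rank1Residual
  Literature.NumberTheory.EllipticCurves.BurungaleCastellaSkinner2025
  Literature.NumberTheory.EllipticCurves.YanZhu2026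
  Summit.BirchSwinnertonDyer.BirchSwinnertonDyer.Theorems.Rank1ResidualX1Defs

namespace Summit.BirchSwinnertonDyer.Rank1Residual

section Curve

variable {W : WeierstrassCurve ℚ} [W.IsElliptic] [W.IsGloballyMinimal] {p : ℕ} [Fact p.Prime]

/-! ### §1. Adapter: Yan–Zhu 2026 Thm. 4.9 (typed) IS the typed main conjecture at an odd prime -/

/-- **Yan–Zhu 2026 Thm. 4.9 (second clause) ⇒ `MazurMainConjecture W p`** at a good ordinary ODD `p`
with (irr) and (Im): the named fact `YanZhu2026.thm49_charIdeal_eq_padicLFunction_integral` is,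
binder for binder, the cell's `@[conjecture]` predicate. [cite: YanZhu2024MainConjNonCM, Thm. 4.9 (§4.4)] -/
theorem mazurMainConjecture_of_yzThm49 (hYZ : thm49_charIdeal_eq_padicLFunction_integral)
    (hp : 3 ≤ p) (hord : GoodOrd W p) (hirr : Irr W p) (him : BigIm W p) :
    MazurMainConjecture W p :=
  hYZ W p hp hord hirr him

/-- **Row C16 feeds the adapter** (`p = 3`, good ordinary, (irr), surj(3) ∨ (ram)): (Im) at `3` from
surj(3) + good reduction at `3` via Wuthrich 2014 Lemma 20 (`hW20`: `3`-adic surjectivity;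
`X9.bigIm_three_of_surj`), or from (irr) + (ram) at any prime (`X9.bigIm_of_irr_of_ram`).
[cite: YanZhu2024MainConjNonCM, Thm. 4.9 (§4.4)] [cite: Wuthrich2014, Lemma 20 (p. 399)] -/
theorem RowC16.mazurMainConjecture_of_yzThm49 (hYZ : thm49_charIdeal_eq_padicLFunction_integral)
    (hW20 : Wuthrich2014.lemma20_surjective_threeAdic_of_semistable) (h : RowC16 W p) :
    MazurMainConjecture W p := by
  obtain ⟨hp3, hord, hirr, hsr⟩ := h
  subst hp3
  have him : BigIm W 3 := by
    rcases hsr with hs | hram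
    · exact X9.bigIm_three_of_surj W hW20 (Or.inl hord.1) hs
    · exact X9.bigIm_of_irr_of_ram W 3 hirr hram
  exact mazurMainConjecture_of_yzThm49 hYZ le_rfl hord hirr him

end Curve

/-- **As statements, Yan–Zhu's Thm. 4.9 (second clause, `p > 2`) contains Burungale–Castella–Skinner's
Thm. 1.1.2 (b) (`p > 3`)**: same binders, `3 < p ⇒ 3 ≤ p` (Rem. 1.3: "[BCS] proved … the integral
version if (Im) also holds. Their results don't cover ours, nor do ours cover theirs" — refers to the
PROOFS' hypotheses on the newform side; for elliptic curves over `ℚ` the printed STATEMENTS nest).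
[cite: YanZhu2024MainConjNonCM, Thm. 4.9 and Rem. 1.3] [cite: BurungaleCastellaSkinner2025, Thm. 1.1.2 (b)] -/
theorem bcsThm112b_of_yzThm49 (hYZ : thm49_charIdeal_eq_padicLFunction_integral) :
    thm112b_charIdeal_eq_padicLFunction_integral :=
  fun W _ _ p _ hp hord hirr him ↦ hYZ W p (by omega) hord hirr him

/-- **The irreducible good-ordinary column at `p = 3` is partitioned, no cell unaccounted**: granted
Yan–Zhu Thm. 4.9 and Wuthrich 2014 Lemma 20, "Mazur's (integral, Néron-normalised) main conjecture
for EVERY `E/ℚ` good ordinary at `3` with `E[3]` irreducible" is EQUIVALENT to the same on the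
NON-SURJECTIVE pairs only — the image locus `irr(3) ∧ ¬surj(3)` of the cell's typed sub-class X10b.
[cite: YanZhu2024MainConjNonCM, Thm. 4.9] [cite: Wuthrich2014, Lemma 20 (p. 399)] -/
theorem forall_mazurMainConjecture_irreducible_three_iff_nonSurj
    (hYZ : thm49_charIdeal_eq_padicLFunction_integral)
    (hW20 : Wuthrich2014.lemma20_surjective_threeAdic_of_semistable) :
    (∀ (W : WeierstrassCurve ℚ) [W.IsElliptic] [W.IsGloballyMinimal],
        GoodOrd W 3 → Irr W 3 → MazurMainConjecture W 3) ↔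
      (∀ (W : WeierstrassCurve ℚ) [W.IsElliptic] [W.IsGloballyMinimal],
        GoodOrd W 3 → Irr W 3 → ¬ Surj W 3 → MazurMainConjecture W 3) := by
  constructor
  · intro h W _ _ hord hirr _
    exact h W hord hirr
  · intro h W _ _ hord hirr
    by_cases hs : Surj W 3
    · exact mazurMainConjecture_of_yzThm49 hYZ le_rfl hord hirr
        (X9.bigIm_three_of_surj W hW20 (Or.inl hord.1) hs)
    · exact h W hord hirr hs

section Curve

variable {W : WeierstrassCurve ℚ} [W.IsElliptic] [W.IsGloballyMinimal] {p : ℕ} [Fact p.Prime]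

/-! ### §2. Row C16 ∩ {r = 0}: Yan–Zhu Thm. 4.15 (r = 0) re-assembled — no `@[conjecture]` binder left -/

/-- **C16 ∩ {r = 0} at main-conjecture level, the main conjecture now a PUBLISHED fact**: Yan–Zhu
Thm. 4.9 (`hYZ`) + the (Im) witness at `3` (`hW20` / (ram)) + Greenberg 1999 Thm. 4.1 (`hGr`, odd `p`)
+ modularity + GZK ⇒ `BSD(E,3)`, feeding gen-0's `RowC16.bsdp_rankZero_of_mazurMainConjecture`. This
is the printed proof of Thm. 4.15, case `r = 0` ("comes from (the integral part of) Theorem (cyc) and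
descent arguments (see [SU14])", §4.6). Compare `RowC16.bsdp` (Partition/Bsdp: Thm. 4.15 itself).
[cite: YanZhu2024MainConjNonCM, Thm. 4.15 (r = 0) and its proof (§4.6), Thm. 4.9]
[cite: GreenbergLNM1716, Thm. 4.1 (p. 102)] [cite: Wuthrich2014, Lemma 20 (p. 399)] -/
theorem RowC16.bsdp_rankZero_of_yzThm49 (hYZ : thm49_charIdeal_eq_padicLFunction_integral)
    (hW20 : Wuthrich2014.lemma20_surjective_threeAdic_of_semistable)
    (hGr : greenberg_charValue_rankZero) (hmod : nonempty_modularParametrizationData)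
    (hGZK : rank_eq_analyticRank_of_analyticRank_le_one) (h : RowC16 W p)
    (hr0 : W.analyticRank = 0) : BSDp W p :=
  RowC16.bsdp_rankZero_of_mazurMainConjecture hGr hmod hGZK h hr0
    (RowC16.mazurMainConjecture_of_yzThm49 hYZ hW20 h)

end Curve

/-! ### §3. Row C16 ∩ {r = 1} along its printed route (anticyclotomic), through the generic class-level theorem -/

/-- **C16 ∩ {r = 1}, `3 ∤ ∏ c_ℓ`, along its PRINTED route** (Yan–Zhu Thm. 4.15, `r = 1`: "the rank
`1` `p`-part BSD formula comes from (the integral part of) Theorem (ac) and descent arguments (see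
[JSW])", with `K` "such that `p` is split in `K` and `(E,K)` satisfies the Heegner hypothesis"):
published named facts + the typed STEP L `X11b.IndexLowerBoundAt W 3 K P` at every Manin-unit classical
Heegner datum over a field with `d_K` odd `< −4`, every `ℓ ∣ N` and `3` split ⇒ `BSD(E,3)`. Instance of
`bsdp_rankOne_of_indexLowerBoundAt_of_columnMainConjecture` with `hMC` = Yan–Zhu Thm. 4.9 at `3`
(`hYZ`), `hIm` = Wuthrich Lemma 20 (`hW20`, `X9.bigIm_three_of_surj`), and surj(3) from the row
((ram) ∧ (irr) ⇒ surj, `surj_of_irr_of_ram`). [cite: YanZhu2024MainConjNonCM, Thm. 4.15 (r = 1) and its proof (§4.6); Thm. 4.12; Thm. 4.9]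
[cite: Wuthrich2014, Lemma 20 (p. 399)] [cite: Miller2011LMS, Def. 1.1] -/
theorem RowC16.bsdp_rankOne_of_indexLowerBoundAt_of_yzThm49
    (hGZ : ∀ (N : ℕ) [NeZero N] (W : WeierstrassCurve ℚ) (K : Type) [Field K] [NumberField K],
      gross_zagier N W K)
    (hKo : ∀ (N : ℕ) [NeZero N] (W : WeierstrassCurve ℚ) (K : Type) [Field K] [NumberField K],
      kolyvagin N W K)
    (hB : ∀ (N : ℕ) [NeZero N] (W : WeierstrassCurve ℚ) (K : Type) [Field K] [NumberField K],
      Kolyvagin1990_padicValNat_card_sha_le N W K)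
    (hYZ : thm49_charIdeal_eq_padicLFunction_integral)
    (hW20 : Wuthrich2014.lemma20_surjective_threeAdic_of_semistable)
    (hGr : greenberg_charValue_rankZero) (hGZK : rank_eq_analyticRank_of_analyticRank_le_one)
    (hmod : hasEntireLFunction_rat) (hpar : nonempty_modularParametrizationData)
    (hnf : exists_isNewformOf) (hHL : HoffsteinLuo1997_exists_twist_L_one_ne_zero)
    (hMaz : mazur_not_dvd_maninConstant_of_odd) (hNS : integral_neronScaling_of_isGloballyMinimal)
    (hL : ∀ (W : WeierstrassCurve ℚ) [W.IsElliptic] [W.IsGloballyMinimal] (p : ℕ) [Fact p.Prime]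
      (N : ℕ) [NeZero N] (K : Type) [Field K] [NumberField K]
      (Dt : ModularParametrizationData W N) (H : HeegnerDatum N (NumberField.discr K)) (ι : K →+* ℂ)
      (P : (W.baseChange K).toAffine.Point),
      RowC16 W p → W.analyticRank = 1 → ¬ p ∣ W.tamagawaProduct →
      W.conductorNorm ℤ = N → IsImaginaryQuadratic K → Odd (NumberField.discr K) →
      NumberField.discr K < -4 → SatisfiesHeegnerHypothesis N K → SatisfiesHeegnerHypothesis p K →
      (W.quadraticTwist (NumberField.discr K : ℚ)).entireLFunction 1 ≠ 0 →
      WeierstrassCurve.Affine.Point.map ι.toRatAlgHom P = heegnerPointComplex Dt H →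
      ¬ (p : ℤ) ∣ Dt.c → X11b.IndexLowerBoundAt W p K P)
    (W : WeierstrassCurve ℚ) [W.IsElliptic] [W.IsGloballyMinimal] (p : ℕ) [Fact p.Prime]
    (h : RowC16 W p) (hr1 : W.analyticRank = 1) (htam0 : ¬ p ∣ W.tamagawaProduct) : BSDp W p := by
  obtain ⟨hp3, hord, hirr, hsr⟩ := h
  have hsurj : Surj W p := by
    rcases hsr with hs | hram
    · exact hs
    · exact surj_of_irr_of_ram W p hirr hram
  subst hp3
  exact bsdp_rankOne_of_indexLowerBoundAt_of_columnMainConjecture hGZ hKo hB hGr hGZK hmod hpar hnf hHL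
    hMaz hNS W 3 le_rfl hord hsurj hr1 htam0
    (fun V _ _ hordV hirrV himV ↦ hYZ V 3 le_rfl hordV hirrV himV)
    (fun V _ _ hordV hsV ↦ X9.bigIm_three_of_surj V hW20 (Or.inl hordV.1) hsV)
    (fun N _ K _ _ Dt H ι P hN hK hodd hlt hHN hHp hLt hP hc ↦
      hL W 3 N K Dt H ι P ⟨rfl, hord, hirr, hsr⟩ hr1 htam0 hN hK hodd hlt hHN hHp hLt hP hc)

/-- **Row C16 (`r ≤ 1`) entirely at "typed main conjecture (PUBLISHED: Yan–Zhu Thm. 4.9) + typed STEP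
L (antecedent PUBLISHED: Yan–Zhu Thm. 4.12) + cited control"**, no `@[conjecture]`, no Schneider
certificate: `r = 0` by `RowC16.bsdp_rankZero_of_yzThm49`; `r = 1` (with `3 ∤ ∏c_ℓ`) by
`RowC16.bsdp_rankOne_of_indexLowerBoundAt_of_yzThm49`. [cite: YanZhu2024MainConjNonCM, Thm. 4.15 and its proof (§4.6)]
[cite: Miller2011LMS, Def. 1.1] -/
theorem RowC16.bsdp_of_yzThm49_of_indexLowerBoundAt
    (hGZ : ∀ (N : ℕ) [NeZero N] (W : WeierstrassCurve ℚ) (K : Type) [Field K] [NumberField K],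
      gross_zagier N W K)
    (hKo : ∀ (N : ℕ) [NeZero N] (W : WeierstrassCurve ℚ) (K : Type) [Field K] [NumberField K],
      kolyvagin N W K)
    (hB : ∀ (N : ℕ) [NeZero N] (W : WeierstrassCurve ℚ) (K : Type) [Field K] [NumberField K],
      Kolyvagin1990_padicValNat_card_sha_le N W K)
    (hYZ : thm49_charIdeal_eq_padicLFunction_integral)
    (hW20 : Wuthrich2014.lemma20_surjective_threeAdic_of_semistable)
    (hGr : greenberg_charValue_rankZero) (hGZK : rank_eq_analyticRank_of_analyticRank_le_one)
    (hmod : hasEntireLFunction_rat) (hpar : nonempty_modularParametrizationData)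
    (hnf : exists_isNewformOf) (hHL : HoffsteinLuo1997_exists_twist_L_one_ne_zero)
    (hMaz : mazur_not_dvd_maninConstant_of_odd) (hNS : integral_neronScaling_of_isGloballyMinimal)
    (hL : ∀ (W : WeierstrassCurve ℚ) [W.IsElliptic] [W.IsGloballyMinimal] (p : ℕ) [Fact p.Prime]
      (N : ℕ) [NeZero N] (K : Type) [Field K] [NumberField K]
      (Dt : ModularParametrizationData W N) (H : HeegnerDatum N (NumberField.discr K)) (ι : K →+* ℂ)
      (P : (W.baseChange K).toAffine.Point),
      RowC16 W p → W.analyticRank = 1 → ¬ p ∣ W.tamagawaProduct →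
      W.conductorNorm ℤ = N → IsImaginaryQuadratic K → Odd (NumberField.discr K) →
      NumberField.discr K < -4 → SatisfiesHeegnerHypothesis N K → SatisfiesHeegnerHypothesis p K →
      (W.quadraticTwist (NumberField.discr K : ℚ)).entireLFunction 1 ≠ 0 →
      WeierstrassCurve.Affine.Point.map ι.toRatAlgHom P = heegnerPointComplex Dt H →
      ¬ (p : ℤ) ∣ Dt.c → X11b.IndexLowerBoundAt W p K P)
    (W : WeierstrassCurve ℚ) [W.IsElliptic] [W.IsGloballyMinimal] (p : ℕ) [Fact p.Prime]
    (h : RowC16 W p) (hr : W.analyticRank ≤ 1)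
    (htam0 : W.analyticRank = 1 → ¬ p ∣ W.tamagawaProduct) : BSDp W p := by
  rcases Nat.lt_or_ge W.analyticRank 1 with h0 | h1
  · exact RowC16.bsdp_rankZero_of_yzThm49 hYZ hW20 hGr hpar hGZK h (by omega)
  · have hr1 : W.analyticRank = 1 := le_antisymm hr h1
    exact RowC16.bsdp_rankOne_of_indexLowerBoundAt_of_yzThm49 hGZ hKo hB hYZ hW20 hGr hGZK hmod hpar
      hnf hHL hMaz hNS hL W p h hr1 (htam0 hr1)

end Summit.BirchSwinnertonDyer.Rank1Residual

end
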